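import Summits.Ventures.Crystal3D.Theorems.StickyWulffConstantCoaxialWallLawTripleVacancyLattice
import Summits.Ventures.Crystal3D.Theorems.StickyWulffConstantCoaxialWallLawDoubleVacancyLattice
import Summits.Ventures.Crystal3D.Theorems.StickyWulffConstantCoaxialWallLawTwinWord
import Summits.Ventures.Crystal3D.Theorems.StickyWulffConstantGenericWallFloorSlotSum
import Summits.Ventures.Crystal3D.Theorems.StickyWulffConstantGenericWallFloorTwinAxis
import HarnessLib

/-!
# The crude absorption inequality (rigid rung of `stub_coaxialTwoSlabAdhesion`): dichotomy and twin pair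

HONEST FRAMING. Part of the venture `Summits/Ventures/Crystal3D` (cell `crystal3d-full`), helper
`--supports` the crux `CoaxialWallLaw` (stmt-Ventures-19481, `route-Ventures-StickyWulffConstant`),
REGISTERED line `WallLedgerF` (planner cf-p1 gen 16), stub `stub_coaxialTwoSlabAdhesion`
(terrace/riser slot ledger).  Per-ball ABSORPTION step of the rigid rung in the normalised frame:
host grain the model lattice `Λ₀`, foreign grain a moved lattice `A·Λ₀ + t`, every ball of the
packing on one of the two grains.
* `absorption_inPlane_or_faceTwin` — for `x ∈ Λ₀` off the foreign grain EITHER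
  `#{in-plane slots w of x (w₂ = 0) with x + w ∉ X} + 4 · deg_X(x) ≤ 48` (i.e.
  `12 − deg ≥ ¼ · #vacant in-plane slots`) OR the FACE-TWIN PATTERN with an in-plane vacancy holds
  (vacancies = a triangular face with a horizontal slot, the three twin positions are foreign
  balls).  Proof: foreign contacts `f ≤ 3` (L3′, `rung_offLatticeMoved`); `f ≥ 1 ⇒ ≥ 2`
  vacancies, `f ≥ 2 ⇒ ≥ 3` (`fcc_foreign_blocks_two`, `fcc_two_foreign_block_three`); `f = 3`
  with three vacancies is the face-twin pattern (`fcc_triple_vacancy`); the rest is arithmetic.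
* `twin_absorption_inPlane` — foreign grain the TWIN `R·Λ₀ + s` (`R` the half-turn about `e₃`,
  `R·Λ₀ = Λ₀⁻`): the second branch is impossible, since the twin triple's mutual differences lie
  in `Λ₀ ∩ Λ₀⁻`, hence are horizontal (`apply_two_eq_zero_of_mem_fcc_inter_twin`), and three
  horizontal unit vectors pairwise at distance `1` do not exist (`no_coplanar_unit_tetrahedron`).
Summed over a grain and combined with the riser count (`coaxial_inPlane_vacancies`) this gives the
wall term `≥ (√6/4) sin θ · πρ²` of the rigid twin rung, above the stub's `½ sin θ · πρ²`.
WHAT THIS IS NOT: coincidence sites, translation pairs (second branch ⇒ axis rule), the cell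
bookkeeping of the stub; rung F-C1 not moved.
-/

noncomputable section

namespace Summit.Ventures.Crystal3D.Theorems

open Summit.Ventures.Crystal3D Finset
open Literature.MathematicalPhysics.StatisticalMechanics (barlowPos barlowStacking fccStacking
  constHagg barlowPos_mem)

/-- Pigeonhole: three pairwise distinct elements drawn from `{τ₁, τ₂, τ₃}` exhaust it. -/
theorem three_cover {α : Type*} (y₁ y₂ y₃ τ₁ τ₂ τ₃ : α) (h12 : y₁ ≠ y₂) (h13 : y₁ ≠ y₃)
    (h23 : y₂ ≠ y₃) (t1 : y₁ = τ₁ ∨ y₁ = τ₂ ∨ y₁ = τ₃) (t2 : y₂ = τ₁ ∨ y₂ = τ₂ ∨ y₂ = τ₃)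
    (t3 : y₃ = τ₁ ∨ y₃ = τ₂ ∨ y₃ = τ₃) :
    (τ₁ = y₁ ∨ τ₁ = y₂ ∨ τ₁ = y₃) ∧ (τ₂ = y₁ ∨ τ₂ = y₂ ∨ τ₂ = y₃) ∧
      (τ₃ = y₁ ∨ τ₃ = y₂ ∨ τ₃ = y₃) := by
  rcases t1 with rfl | rfl | rfl <;> rcases t2 with rfl | rfl | rfl <;>
    rcases t3 with h3 | h3 | h3 <;> subst_vars <;> simp_all

/-- **No planar unit tetrahedron star.**  Three unit vectors in the plane `x₂ = 0` pairwise at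
distance `1` do not exist (their Gram determinant would be `1/2`, but it vanishes in `ℝ²`). -/
theorem no_coplanar_unit_tetrahedron (a b c : EuclideanSpace ℝ (Fin 3)) (ha2 : a 2 = 0)
    (hb2 : b 2 = 0) (hc2 : c 2 = 0) (ha : ‖a‖ = 1) (hb : ‖b‖ = 1) (hc : ‖c‖ = 1)
    (hab : ‖a - b‖ = 1) (hac : ‖a - c‖ = 1) (hbc : ‖b - c‖ = 1) : False := by
  have e : ∀ v : EuclideanSpace ℝ (Fin 3), ‖v‖ ^ 2 = v 0 ^ 2 + v 1 ^ 2 + v 2 ^ 2 := fun v => by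
    rw [EuclideanSpace.real_norm_sq_eq, Fin.sum_univ_three]
  have na := e a; have nb := e b; have nc := e c; have nab := e (a - b); have nac := e (a - c)
  have nbc := e (b - c)
  simp only [PiLp.sub_apply] at nab nac nbc
  rw [ha] at na; rw [hb] at nb; rw [hc] at nc; rw [hab] at nab; rw [hac] at nac; rw [hbc] at nbc
  rw [ha2] at na nab nac; rw [hb2] at nb nab nbc; rw [hc2] at nc nac nbc
  obtain ⟨pa, pb, pc⟩ : a 0 ^ 2 + a 1 ^ 2 = 1 ∧ b 0 ^ 2 + b 1 ^ 2 = 1 ∧ c 0 ^ 2 + c 1 ^ 2 = 1 :=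
    ⟨by linarith, by linarith, by linarith⟩
  obtain ⟨qab, qac, qbc⟩ : a 0 * b 0 + a 1 * b 1 = 1 / 2 ∧ a 0 * c 0 + a 1 * c 1 = 1 / 2 ∧
      b 0 * c 0 + b 1 * c 1 = 1 / 2 := ⟨by linarith, by linarith, by linarith⟩
  have hG : (a 0 ^ 2 + a 1 ^ 2) * ((b 0 ^ 2 + b 1 ^ 2) * (c 0 ^ 2 + c 1 ^ 2) -
      (b 0 * c 0 + b 1 * c 1) ^ 2) -
      (a 0 * b 0 + a 1 * b 1) * ((a 0 * b 0 + a 1 * b 1) * (c 0 ^ 2 + c 1 ^ 2) -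
        (b 0 * c 0 + b 1 * c 1) * (a 0 * c 0 + a 1 * c 1)) +
      (a 0 * c 0 + a 1 * c 1) * ((a 0 * b 0 + a 1 * b 1) * (b 0 * c 0 + b 1 * c 1) -
        (b 0 ^ 2 + b 1 ^ 2) * (a 0 * c 0 + a 1 * c 1)) = 0 := by ring
  rw [pa, pb, pc, qab, qac, qbc] at hG
  norm_num at hG

/-- Differences of two points of the moved twin `R·Λ₀ + s` lie in `Λ₀⁻` (`R` the half-turn). -/
theorem sub_mem_twin_of_mem_movedTwin {s τ τ' : EuclideanSpace ℝ (Fin 3)}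
    (hτ : τ ∈ (fun p => (ℝ ∙ EuclideanSpace.single (2 : Fin 3) (1 : ℝ)).reflection p + s) ''
      fccStacking 1 (Real.sqrt (2 / 3)))
    (hτ' : τ' ∈ (fun p => (ℝ ∙ EuclideanSpace.single (2 : Fin 3) (1 : ℝ)).reflection p + s) ''
      fccStacking 1 (Real.sqrt (2 / 3))) :
    τ - τ' ∈ barlowStacking 1 (Real.sqrt (2 / 3)) (fun _ => (-1 : ℤ)) := by
  obtain ⟨p, hp, rfl⟩ := hτ
  obtain ⟨p', hp', rfl⟩ := hτ'
  rw [barlowStacking_negConst_eq_halfTurn_image]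
  refine ⟨p - p', fcc_sub_site_mem hp hp', ?_⟩
  simp only [map_sub]
  abel

/-- **The crude absorption dichotomy, host on the model grain, arbitrary foreign grain.**  `X` a
unit packing on `Λ₀ ∪ (A·Λ₀ + t)`, `x ∈ Λ₀` off the foreign grain.  EITHER the number of vacant
in-plane slots of `x` is at most `4 (12 − deg x)`, OR `x` is in the FACE-TWIN PATTERN with an
in-plane vacancy: its vacant slots are exactly a triangular face `x + w₁, x + w₂, x + w₃` of its
slot shell with `w₁` horizontal, and the three twin positions `x + (2/3)(w₁+w₂+w₃) − wⱼ` are balls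
of `X` on the foreign grain. -/
theorem absorption_inPlane_or_faceTwin
    (A : EuclideanSpace ℝ (Fin 3) ≃ₗᵢ[ℝ] EuclideanSpace ℝ (Fin 3)) (t : EuclideanSpace ℝ (Fin 3))
    (X : Finset (EuclideanSpace ℝ (Fin 3)))
    (hX : ∀ p ∈ X, ∀ q ∈ X, p ≠ q → 1 ≤ dist p q)
    (hXΛ : ∀ p ∈ X, p ∈ fccStacking 1 (Real.sqrt (2 / 3)) ∨
      p ∈ (fun q => A q + t) '' fccStacking 1 (Real.sqrt (2 / 3)))
    (x : EuclideanSpace ℝ (Fin 3)) (hxΛ : x ∈ fccStacking 1 (Real.sqrt (2 / 3)))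
    (hxs : x ∉ (fun q => A q + t) '' fccStacking 1 (Real.sqrt (2 / 3))) :
    (fccSlots.filter fun w => w 2 = 0 ∧ x + w ∉ X).card +
      4 * (X.filter fun y => dist x y = 1).card ≤ 48 ∨
    ∃ w₁ ∈ fccSlots, ∃ w₂ ∈ fccSlots, ∃ w₃ ∈ fccSlots, w₁ ≠ w₂ ∧ w₁ ≠ w₃ ∧ w₂ ≠ w₃ ∧
      dist w₁ w₂ = 1 ∧ dist w₁ w₃ = 1 ∧ dist w₂ w₃ = 1 ∧ w₁ 2 = 0 ∧
      x + w₁ ∉ X ∧ x + w₂ ∉ X ∧ x + w₃ ∉ X ∧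
      (x + ((2 / 3 : ℝ) • (w₁ + w₂ + w₃) - w₁) ∈ X ∧
        x + ((2 / 3 : ℝ) • (w₁ + w₂ + w₃) - w₁) ∈ (fun q => A q + t) '' fccStacking 1 (Real.sqrt (2 / 3))) ∧
      (x + ((2 / 3 : ℝ) • (w₁ + w₂ + w₃) - w₂) ∈ X ∧
        x + ((2 / 3 : ℝ) • (w₁ + w₂ + w₃) - w₂) ∈ (fun q => A q + t) '' fccStacking 1 (Real.sqrt (2 / 3))) ∧
      (x + ((2 / 3 : ℝ) • (w₁ + w₂ + w₃) - w₃) ∈ X ∧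
        x + ((2 / 3 : ℝ) • (w₁ + w₂ + w₃) - w₃) ∈ (fun q => A q + t) '' fccStacking 1 (Real.sqrt (2 / 3))) := by
  classical
  set T := (fun q => A q + t) '' fccStacking 1 (Real.sqrt (2 / 3)) with hT
  -- neighbours, split by grain
  set N := X.filter fun y => dist x y = 1 with hN
  set N₂ := N.filter fun y => y ∉ fccStacking 1 (Real.sqrt (2 / 3)) with hN₂
  have hNsplit : (N.filter fun y => y ∈ fccStacking 1 (Real.sqrt (2 / 3))).card + N₂.card = N.card :=
    card_filter_add_card_filter_not _
  -- occupied and vacant slots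
  set V := fccSlots.filter fun w => x + w ∉ X with hV
  have hOV : (fccSlots.filter fun w => x + w ∈ X).card + V.card = 12 := by
    rw [hV, card_filter_add_card_filter_not]; exact card_fccSlots
  -- own-grain contacts = occupied slots
  have hN₁ : (N.filter fun y => y ∈ fccStacking 1 (Real.sqrt (2 / 3))).card =
      (fccSlots.filter fun w => x + w ∈ X).card := by
    set P := X.filter fun y => y ∈ fccStacking 1 (Real.sqrt (2 / 3)) with hP
    have hPΛ : ∀ q ∈ P, q ∈ fccStacking 1 (Real.sqrt (2 / 3)) := fun q hq => (mem_filter.1 hq).2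
    have h1 : N.filter (fun y => y ∈ fccStacking 1 (Real.sqrt (2 / 3))) =
        P.filter fun y => dist x y = 1 := by
      rw [hN, hP, filter_filter, filter_filter]
      exact filter_congr fun y _ => and_comm
    have h2 : (fccSlots.filter fun w => x + w ∈ P) = fccSlots.filter fun w => x + w ∈ X := by
      refine filter_congr fun w hw => ?_
      rw [hP, mem_filter]
      exact ⟨fun h => h.1, fun h => ⟨h, add_mem_fcc_of_mem_fccSlots hxΛ hw⟩⟩
    rw [h1, card_contacts_eq_card_occupied_slots P hPΛ x hxΛ, h2]
  -- foreign contacts: at most three (L3′)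
  have hN₂mem : ∀ y ∈ N₂, y ∈ X ∧ dist x y = 1 ∧ y ∉ fccStacking 1 (Real.sqrt (2 / 3)) ∧ y ∈ T := by
    intro y hy
    obtain ⟨hyN, hyΛ⟩ := mem_filter.1 hy
    obtain ⟨hyX, hyd⟩ := mem_filter.1 hyN
    exact ⟨hyX, hyd, hyΛ, (hXΛ y hyX).resolve_left hyΛ⟩
  have hf3 : N₂.card ≤ 3 :=
    rung_offLatticeMoved A t x hxs N₂ fun y hy => ⟨(hN₂mem y hy).2.2.2, (hN₂mem y hy).2.1⟩
  -- vacant slots: membership, and blocked ⇒ vacant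
  have hVmem : ∀ w, w ∈ V ↔ w ∈ fccSlots ∧ x + w ∉ X := fun w => by rw [hV, mem_filter]
  have hblocked : ∀ y ∈ X, y ∉ fccStacking 1 (Real.sqrt (2 / 3)) →
      ∀ z ∈ fccStacking 1 (Real.sqrt (2 / 3)), dist x z = 1 → dist y z < 1 → z - x ∈ V := by
    intro y hyX hyΛ z hz hxz hyz
    rw [hVmem]
    refine ⟨sub_mem_fccSlots_of_dist_eq_one hxΛ hz hxz, ?_⟩
    rw [add_sub_cancel]
    intro hzX
    have hne : y ≠ z := fun e => hyΛ (e ▸ hz)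
    have := hX y hyX z hzX hne
    linarith
  -- (A) one foreign contact forces two vacancies
  have hA : 1 ≤ N₂.card → 2 ≤ V.card := by
    intro h1
    obtain ⟨y, hy⟩ := card_pos.1 h1
    obtain ⟨hyX, hyd, hyΛ, -⟩ := hN₂mem y hy
    have hyimg : y ∉ (fun p => (LinearIsometryEquiv.refl ℝ (EuclideanSpace ℝ (Fin 3))) p + 0) ''
        fccStacking 1 (Real.sqrt (2 / 3)) := by
      rintro ⟨p, hp, hpy⟩
      simp only [LinearIsometryEquiv.coe_refl, id_eq, add_zero] at hpy
      exact hyΛ (hpy ▸ hp)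
    obtain ⟨z₁, hz₁, z₂, hz₂, hne, hqz₁, hqz₂, hyz₁, hyz₂⟩ :=
      fcc_foreign_blocks_two (LinearIsometryEquiv.refl ℝ _) 0 x y ⟨x, hxΛ, by simp⟩ hyimg hyd
    obtain ⟨p₁, hp₁, rfl⟩ := hz₁
    obtain ⟨p₂, hp₂, rfl⟩ := hz₂
    simp only [LinearIsometryEquiv.coe_refl, id_eq, add_zero] at hne hqz₁ hqz₂ hyz₁ hyz₂
    have m₁ := hblocked y hyX hyΛ p₁ hp₁ hqz₁ hyz₁
    have m₂ := hblocked y hyX hyΛ p₂ hp₂ hqz₂ hyz₂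
    have hne' : p₁ - x ≠ p₂ - x := fun e => hne (sub_left_injective e)
    calc 2 = ({p₁ - x, p₂ - x} : Finset _).card := (card_pair hne').symm
      _ ≤ V.card := card_le_card (by
          intro w hw
          simp only [mem_insert, mem_singleton] at hw
          rcases hw with rfl | rfl
          exacts [m₁, m₂])
  -- (B) two foreign contacts force three vacancies
  have hB : 2 ≤ N₂.card → 3 ≤ V.card := by
    intro h2
    obtain ⟨y, y', hy, hy', hne⟩ := one_lt_card_iff.1 h2
    obtain ⟨hyX, hyd, hyΛ, -⟩ := hN₂mem y hy
    obtain ⟨hy'X, hy'd, hy'Λ, -⟩ := hN₂mem y' hy'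
    have hyy' : 1 ≤ dist y y' := hX y hyX y' hy'X hne
    have hyimg : y ∉ (fun p => (LinearIsometryEquiv.refl ℝ (EuclideanSpace ℝ (Fin 3))) p + 0) ''
        fccStacking 1 (Real.sqrt (2 / 3)) := by
      rintro ⟨p, hp, hpy⟩
      simp only [LinearIsometryEquiv.coe_refl, id_eq, add_zero] at hpy
      exact hyΛ (hpy ▸ hp)
    obtain ⟨z₁, hz₁, z₂, hz₂, z₃, hz₃, h12, h13, h23, hqz₁, hqz₂, hqz₃, b₁, b₂, b₃⟩ :=
      fcc_two_foreign_block_three (LinearIsometryEquiv.refl ℝ _) 0 x y y' ⟨x, hxΛ, by simp⟩ hyimg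
        hyd hy'd hyy'
    obtain ⟨p₁, hp₁, rfl⟩ := hz₁
    obtain ⟨p₂, hp₂, rfl⟩ := hz₂
    obtain ⟨p₃, hp₃, rfl⟩ := hz₃
    simp only [LinearIsometryEquiv.coe_refl, id_eq, add_zero] at h12 h13 h23 hqz₁ hqz₂ hqz₃ b₁ b₂ b₃
    have mk : ∀ p, p ∈ fccStacking 1 (Real.sqrt (2 / 3)) → dist x p = 1 →
        (dist y p < 1 ∨ dist y' p < 1) → p - x ∈ V := by
      intro p hp hxp hb
      rcases hb with hb | hb
      · exact hblocked y hyX hyΛ p hp hxp hb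
      · exact hblocked y' hy'X hy'Λ p hp hxp hb
    have m₁ := mk p₁ hp₁ hqz₁ b₁
    have m₂ := mk p₂ hp₂ hqz₂ b₂
    have m₃ := mk p₃ hp₃ hqz₃ b₃
    have n12 : p₁ - x ≠ p₂ - x := fun e => h12 (sub_left_injective e)
    have n13 : p₁ - x ≠ p₃ - x := fun e => h13 (sub_left_injective e)
    have n23 : p₂ - x ≠ p₃ - x := fun e => h23 (sub_left_injective e)
    calc 3 = ({p₁ - x, p₂ - x, p₃ - x} : Finset _).card := by
          rw [card_insert_of_notMem, card_pair n23]
          simp only [mem_insert, mem_singleton, not_or]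
          exact ⟨n12, n13⟩
      _ ≤ V.card := card_le_card (by
          intro w hw
          simp only [mem_insert, mem_singleton] at hw
          rcases hw with rfl | rfl | rfl
          exacts [m₁, m₂, m₃])
  -- (C) three foreign contacts and exactly three vacancies: the face-twin pattern, no in-plane vacancy
  have hC : N₂.card = 3 → V.card = 3 → (fccSlots.filter fun w => w 2 = 0 ∧ x + w ∉ X).card = 0 ∨
      ∃ w₁ ∈ fccSlots, ∃ w₂ ∈ fccSlots, ∃ w₃ ∈ fccSlots, w₁ ≠ w₂ ∧ w₁ ≠ w₃ ∧ w₂ ≠ w₃ ∧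
      dist w₁ w₂ = 1 ∧ dist w₁ w₃ = 1 ∧ dist w₂ w₃ = 1 ∧ w₁ 2 = 0 ∧
      x + w₁ ∉ X ∧ x + w₂ ∉ X ∧ x + w₃ ∉ X ∧
      (x + ((2 / 3 : ℝ) • (w₁ + w₂ + w₃) - w₁) ∈ X ∧ x + ((2 / 3 : ℝ) • (w₁ + w₂ + w₃) - w₁) ∈ T) ∧
      (x + ((2 / 3 : ℝ) • (w₁ + w₂ + w₃) - w₂) ∈ X ∧ x + ((2 / 3 : ℝ) • (w₁ + w₂ + w₃) - w₂) ∈ T) ∧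
      (x + ((2 / 3 : ℝ) • (w₁ + w₂ + w₃) - w₃) ∈ X ∧ x + ((2 / 3 : ℝ) • (w₁ + w₂ + w₃) - w₃) ∈ T) := by
    intro hf hv
    obtain ⟨y₁, y₂, y₃, hy12, hy13, hy23, hNe⟩ := card_eq_three.1 hf
    obtain ⟨w₁, w₂, w₃, hw12, hw13, hw23, hVe⟩ := card_eq_three.1 hv
    obtain ⟨hy₁, hy₂, hy₃⟩ : y₁ ∈ N₂ ∧ y₂ ∈ N₂ ∧ y₃ ∈ N₂ := by rw [hNe]; simp
    obtain ⟨hy₁X, hy₁d, hy₁Λ, hy₁T⟩ := hN₂mem y₁ hy₁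
    obtain ⟨hy₂X, hy₂d, hy₂Λ, hy₂T⟩ := hN₂mem y₂ hy₂
    obtain ⟨hy₃X, hy₃d, hy₃Λ, hy₃T⟩ := hN₂mem y₃ hy₃
    obtain ⟨hw₁, hw₂, hw₃⟩ : w₁ ∈ V ∧ w₂ ∈ V ∧ w₃ ∈ V := by rw [hVe]; simp
    obtain ⟨⟨hw₁S, hw₁X⟩, ⟨hw₂S, hw₂X⟩, ⟨hw₃S, hw₃X⟩⟩ := And.intro ((hVmem w₁).1 hw₁)
      (And.intro ((hVmem w₂).1 hw₂) ((hVmem w₃).1 hw₃))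
    -- the three vacant slot sites
    set z₁ := x + w₁ with hz₁
    set z₂ := x + w₂ with hz₂
    set z₃ := x + w₃ with hz₃
    have hzΛ : ∀ {w}, w ∈ fccSlots → x + w ∈ fccStacking 1 (Real.sqrt (2 / 3)) :=
      fun hw => add_mem_fcc_of_mem_fccSlots hxΛ hw
    have hzd : ∀ {w : EuclideanSpace ℝ (Fin 3)}, w ∈ fccSlots → dist x (x + w) = 1 := by
      intro w hw
      rw [dist_eq_norm, sub_add_cancel_left, norm_neg, norm_eq_one_of_mem_fccSlots hw]
    have key := fcc_triple_vacancy x y₁ y₂ y₃ z₁ z₂ z₃ hxΛ (hzΛ hw₁S) (hzΛ hw₂S) (hzΛ hw₃S)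
      (hzd hw₁S) (hzd hw₂S) (hzd hw₃S)
      (fun e => hw12 (add_left_cancel e)) (fun e => hw13 (add_left_cancel e))
      (fun e => hw23 (add_left_cancel e)) hy₁d hy₂d hy₃d hy₁Λ hy₂Λ hy₃Λ
      (hX y₁ hy₁X y₂ hy₂X hy12) (hX y₁ hy₁X y₃ hy₃X hy13) (hX y₂ hy₂X y₃ hy₃X hy23) (by
        intro z hz hxz h1 h2 h3
        -- an occupied slot site: distance ≥ 1 from every foreign ball
        have hzX : z ∈ X := by
          by_contra hzX
          have hwV : z - x ∈ V := (hVmem _).2 ⟨sub_mem_fccSlots_of_dist_eq_one hxΛ hz hxz, by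
            rw [add_sub_cancel]; exact hzX⟩
          rw [hVe] at hwV
          simp only [mem_insert, mem_singleton] at hwV
          rcases hwV with e | e | e
          · exact h1 (by rw [hz₁, ← e, add_sub_cancel])
          · exact h2 (by rw [hz₂, ← e, add_sub_cancel])
          · exact h3 (by rw [hz₃, ← e, add_sub_cancel])
        refine ⟨hX y₁ hy₁X z hzX (fun e => hy₁Λ (e ▸ hz)), hX y₂ hy₂X z hzX (fun e => hy₂Λ (e ▸ hz)),
          hX y₃ hy₃X z hzX (fun e => hy₃Λ (e ▸ hz))⟩)
    obtain ⟨⟨d12, d13, d23⟩, t1, t2, t3⟩ := key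
    -- all three twin positions are foreign balls, hence on the twin grain
    set τ₁ := (2 / 3 : ℝ) • (z₁ + z₂ + z₃) - z₁ with hτ₁
    set τ₂ := (2 / 3 : ℝ) • (z₁ + z₂ + z₃) - z₂ with hτ₂
    set τ₃ := (2 / 3 : ℝ) • (z₁ + z₂ + z₃) - z₃ with hτ₃
    obtain ⟨c1, c2, c3⟩ := three_cover y₁ y₂ y₃ τ₁ τ₂ τ₃ hy12 hy13 hy23 t1 t2 t3
    have hτT : ∀ {τ}, (τ = y₁ ∨ τ = y₂ ∨ τ = y₃) → τ ∈ T := by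
      rintro τ (rfl | rfl | rfl)
      exacts [hy₁T, hy₂T, hy₃T]
    obtain ⟨hτ₁T, hτ₂T, hτ₃T⟩ : τ₁ ∈ T ∧ τ₂ ∈ T ∧ τ₃ ∈ T := ⟨hτT c1, hτT c2, hτT c3⟩
    have hτX : ∀ {τ}, (τ = y₁ ∨ τ = y₂ ∨ τ = y₃) → τ ∈ X := by
      rintro τ (rfl | rfl | rfl)
      exacts [hy₁X, hy₂X, hy₃X]
    obtain ⟨hτ₁X, hτ₂X, hτ₃X⟩ : τ₁ ∈ X ∧ τ₂ ∈ X ∧ τ₃ ∈ X := ⟨hτX c1, hτX c2, hτX c3⟩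
    -- the face-twin data in terms of the slot vectors
    have dz : ∀ {w w' : EuclideanSpace ℝ (Fin 3)}, dist (x + w) (x + w') = dist w w' := by
      intro w w'; rw [dist_eq_norm, dist_eq_norm, add_sub_add_left_eq_sub]
    obtain ⟨d12', d13', d23'⟩ : dist w₁ w₂ = 1 ∧ dist w₁ w₃ = 1 ∧ dist w₂ w₃ = 1 :=
      ⟨by rw [← dz]; exact d12, by rw [← dz]; exact d13, by rw [← dz]; exact d23⟩
    have hτw : ∀ w : EuclideanSpace ℝ (Fin 3), (2 / 3 : ℝ) • (z₁ + z₂ + z₃) - (x + w) =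
        x + ((2 / 3 : ℝ) • (w₁ + w₂ + w₃) - w) := by
      intro w; rw [hz₁, hz₂, hz₃]; module
    have f1 : x + ((2 / 3 : ℝ) • (w₁ + w₂ + w₃) - w₁) ∈ X ∧ x + ((2 / 3 : ℝ) • (w₁ + w₂ + w₃) - w₁) ∈ T := by
      rw [← hτw]; exact ⟨hτ₁X, hτ₁T⟩
    have f2 : x + ((2 / 3 : ℝ) • (w₁ + w₂ + w₃) - w₂) ∈ X ∧ x + ((2 / 3 : ℝ) • (w₁ + w₂ + w₃) - w₂) ∈ T := by
      rw [← hτw]; exact ⟨hτ₂X, hτ₂T⟩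
    have f3 : x + ((2 / 3 : ℝ) • (w₁ + w₂ + w₃) - w₃) ∈ X ∧ x + ((2 / 3 : ℝ) • (w₁ + w₂ + w₃) - w₃) ∈ T := by
      rw [← hτw]; exact ⟨hτ₃X, hτ₃T⟩
    by_cases hin : w₁ 2 = 0 ∨ w₂ 2 = 0 ∨ w₃ 2 = 0
    · -- the face-twin pattern with an in-plane vacancy: report it
      right
      rcases hin with h0 | h0 | h0
      · exact ⟨w₁, hw₁S, w₂, hw₂S, w₃, hw₃S, hw12, hw13, hw23, d12', d13', d23', h0, hw₁X, hw₂X, hw₃X,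
          f1, f2, f3⟩
      · have e : w₂ + w₁ + w₃ = w₁ + w₂ + w₃ := by abel
        refine ⟨w₂, hw₂S, w₁, hw₁S, w₃, hw₃S, hw12.symm, hw23, hw13, ?_, d23', d13', h0, hw₂X, hw₁X,
          hw₃X, ?_, ?_, ?_⟩
        · rw [dist_comm]; exact d12'
        · rw [e]; exact f2
        · rw [e]; exact f1
        · rw [e]; exact f3
      · have e : w₃ + w₁ + w₂ = w₁ + w₂ + w₃ := by abel
        refine ⟨w₃, hw₃S, w₁, hw₁S, w₂, hw₂S, hw13.symm, hw23.symm, hw12, ?_, ?_, d12', h0, hw₃X, hw₁X,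
          hw₂X, ?_, ?_, ?_⟩
        · rw [dist_comm]; exact d13'
        · rw [dist_comm]; exact d23'
        · rw [e]; exact f3
        · rw [e]; exact f1
        · rw [e]; exact f2
    · -- no in-plane vacancy at all
      left
      push Not at hin
      obtain ⟨n1, n2, n3⟩ := hin
      rw [card_eq_zero, filter_eq_empty_iff]
      intro w hw ⟨hw0, hwX⟩
      have hwV : w ∈ V := (hVmem w).2 ⟨hw, hwX⟩
      rw [hVe] at hwV
      simp only [mem_insert, mem_singleton] at hwV
      rcases hwV with rfl | rfl | rfl
      · exact n1 hw0
      · exact n2 hw0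
      · exact n3 hw0
  -- in-plane vacancies are vacancies
  have hVin : (fccSlots.filter fun w => w 2 = 0 ∧ x + w ∉ X).card ≤ V.card :=
    card_le_card fun w hw => by
      rw [hVmem]; exact ⟨(mem_filter.1 hw).1, (mem_filter.1 hw).2.2⟩
  -- arithmetic
  rcases (show N₂.card = 0 ∨ N₂.card = 1 ∨ N₂.card = 2 ∨ N₂.card = 3 by omega) with
    h0 | h1 | h2 | h3
  · left; omega
  · have := hA (by omega)
    left; omega
  · have := hB (by omega)
    left; omega
  · have h3v := hB (by omega)
    by_cases hv : V.card = 3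
    · rcases hC h3 hv with hzero | hex
      · left; omega
      · right; exact hex
    · left; omega

/-- **The crude absorption inequality, twin pair, host on the model grain.**  `X` a unit packing
on `Λ₀ ∪ (R·Λ₀ + s)` (`R` the half-turn about `e₃`), `x ∈ Λ₀` off the twin grain: the number of
vacant in-plane slots of `x` is at most `4 (12 − deg x)`.  The face-twin branch of
`absorption_inPlane_or_faceTwin` is impossible: the twin triple's mutual differences are unit
vectors of `Λ₀ ∩ Λ₀⁻`, hence horizontal (`apply_two_eq_zero_of_mem_fcc_inter_twin`), which would
make `w₁, w₂, w₃` a planar unit triangle of unit vectors (`no_coplanar_unit_tetrahedron`). -/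
theorem twin_absorption_inPlane (s : EuclideanSpace ℝ (Fin 3))
    (X : Finset (EuclideanSpace ℝ (Fin 3)))
    (hX : ∀ p ∈ X, ∀ q ∈ X, p ≠ q → 1 ≤ dist p q)
    (hXΛ : ∀ p ∈ X, p ∈ fccStacking 1 (Real.sqrt (2 / 3)) ∨
      p ∈ (fun q => (ℝ ∙ EuclideanSpace.single (2 : Fin 3) (1 : ℝ)).reflection q + s) ''
        fccStacking 1 (Real.sqrt (2 / 3)))
    (x : EuclideanSpace ℝ (Fin 3)) (hxΛ : x ∈ fccStacking 1 (Real.sqrt (2 / 3)))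
    (hxs : x ∉ (fun q => (ℝ ∙ EuclideanSpace.single (2 : Fin 3) (1 : ℝ)).reflection q + s) ''
      fccStacking 1 (Real.sqrt (2 / 3))) :
    (fccSlots.filter fun w => w 2 = 0 ∧ x + w ∉ X).card +
      4 * (X.filter fun y => dist x y = 1).card ≤ 48 := by
  rcases absorption_inPlane_or_faceTwin (ℝ ∙ EuclideanSpace.single (2 : Fin 3) (1 : ℝ)).reflection s X
      hX hXΛ x hxΛ hxs with h | ⟨w₁, hw₁, w₂, hw₂, w₃, hw₃, -, -, -, d12, d13, d23, h0, -, -, -,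
      ⟨-, hτ₁⟩, ⟨-, hτ₂⟩, ⟨-, hτ₃⟩⟩
  · exact h
  exfalso
  have horiz : ∀ {w w' : EuclideanSpace ℝ (Fin 3)}, w ∈ fccSlots → w' ∈ fccSlots → dist w w' = 1 →
      x + ((2 / 3 : ℝ) • (w₁ + w₂ + w₃) - w) ∈ (fun q =>
        (ℝ ∙ EuclideanSpace.single (2 : Fin 3) (1 : ℝ)).reflection q + s) '' fccStacking 1 (Real.sqrt (2 / 3)) →
      x + ((2 / 3 : ℝ) • (w₁ + w₂ + w₃) - w') ∈ (fun q =>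
        (ℝ ∙ EuclideanSpace.single (2 : Fin 3) (1 : ℝ)).reflection q + s) '' fccStacking 1 (Real.sqrt (2 / 3)) →
      (w' - w) 2 = 0 := by
    intro w w' hw hw' hd hτ hτ'
    have hm := sub_mem_twin_of_mem_movedTwin hτ hτ'
    have he : x + ((2 / 3 : ℝ) • (w₁ + w₂ + w₃) - w) - (x + ((2 / 3 : ℝ) • (w₁ + w₂ + w₃) - w')) =
        w' - w := by abel
    rw [he] at hm
    exact apply_two_eq_zero_of_mem_fcc_inter_twin
      (fcc_sub_site_mem (mem_fcc_of_mem_fccSlots hw') (mem_fcc_of_mem_fccSlots hw)) hm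
      (by rw [← dist_eq_norm, dist_comm, hd])
  have g12 := horiz hw₁ hw₂ d12 hτ₁ hτ₂
  have g13 := horiz hw₁ hw₃ d13 hτ₁ hτ₃
  simp only [PiLp.sub_apply] at g12 g13
  refine no_coplanar_unit_tetrahedron w₁ w₂ w₃ h0 (by linarith) (by linarith)
    (norm_eq_one_of_mem_fccSlots hw₁) (norm_eq_one_of_mem_fccSlots hw₂)
    (norm_eq_one_of_mem_fccSlots hw₃) ?_ ?_ ?_
  · rw [← dist_eq_norm, d12]
  · rw [← dist_eq_norm, d13]
  · rw [← dist_eq_norm, d23]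

end Summit.Ventures.Crystal3D.Theorems

end
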